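import Summits.AtomisticToContinuum.BoseEinsteinCondensation.Theses.BECRichardsonGaudin
import HarnessLib

/-!
# Route `BECRichardsonGaudin`, crux `RichardsonAnchorBEC` (stmt-AtomisticToContinuum-14805) — vocabulary of the line

`Defs` file of the crux line `registered` (skeleton `Summits/…/Cruxes/RichardsonAnchorBEC/Lines/registered.lean`,
`PICKED.md`, lead prover). A `Cruxes/…/Lines/*.lean` skeleton is not an importable module, so the OBJECTS the line
posits live here, to be imported verbatim by the stub files `Theorems/BECRichardsonGaudinRichardsonAnchorBEC*.lean`
(landed `--supports stmt-AtomisticToContinuum-14805`) and by the closing composition `RichardsonAnchorBEC_of`: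

* `anchorE γ κ ρ n Λ` — the anchor functional of the crux with a FREE shift `κ` on the torus of side
  `L = L_N(ρ)`, `N = n + 2`: `E_κ(Φ) = ∫|∇Φ|² + κ(N − n₀(Φ)) + (γ/L⁹)(N(N−1)/2)∫|∫∫conj(w_M)Φ|²`, verbatim the
  `let`-chain of `RichardsonAnchorBEC` with `2ργ` replaced by `κ` (so the crux is, DEFINITIONALLY, the statement
  about `anchorE γ (2ργ) ρ n Λ`: `RichardsonAnchorBEC_iff`, `Iff.rfl`). Second-quantised it is `⟨Φ, H_κΦ⟩`,
  `H_κ = Σ_k k²n_k + κΣ_{k≠0}n_k + (γ/2V)P†_M P_M` (dictionary: `TorusFockLayer.lintegral_sum_modeAn_modeAn_sq`);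
* `bandBubble L M` — the zero-energy pair bubble of the band, `J_M(L) = (1/2L³) Σ_{m∈B_M∖0} 1/k_m²`,
  `k_m = 2π|m|/L` (the band-limited zero-momentum pair `T`-matrix of the anchor is the Born series `γ/(1+γJ_M)`;
  `J_M → c_□Λ` as `L → ∞` with `M = ⌊ΛL/2π⌋`);
* `bornEnergy γ ρ n Λ` — the Born-renormalised Hartree energy `e_ref = γρN/(2(1+γJ_M(L)))`, the reference energy
  through which the line splits the crux into an upper bound (`stub_bornTrialState`) and a condensate-penalised
  lower bound (assembled from `stub_pairSquareLower`, `stub_crossTermLower`, `stub_bandKineticLower`,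
  `stub_condensatePairJensen`, `stub_bandBubbleLower`);
* basic API: `RichardsonAnchorBEC_iff` (= the registered vocabulary stub `stub_anchorDefs`), `sideLength_succ_succ_pos`, `bandBubble_nonneg`, `bornEnergy_nonneg`,
  `anchorE_zero` (at `γ = 0` the anchor is the free kinetic energy).

No statement of the crux or of a stub is restated here as a fact; these are definitions of a proof plan. [folklore]
-/

noncomputable section

namespace Summit.AtomisticToContinuum.BoseEinsteinCondensation.Cruxes.RichardsonAnchorBEC.Birth

open MeasureTheory Filter
open scoped ENNReal NNReal
open Literature.MathematicalPhysics.QuantumManyBody.BoseGas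
open Summit.AtomisticToContinuum.BoseEinsteinCondensation.Theses.BECRichardsonGaudin

/-! ## The anchor functional with a free shift, and the Born-renormalised reference energy -/

/-- **The anchor functional with shift `κ`** on the torus of side `L = L_N(ρ)`, `N = n + 2`, band
`M = ⌊ΛL/2π⌋`: `E_κ(Φ) = ∫|∇Φ|² + κ (N - n₀(Φ)) + (γ/L⁹)(N(N-1)/2) ∫_{cell^{N-2}} |∫∫ conj(w_M(x,y)) Φ(x,y,Y) dx dy|² dY`
— VERBATIM the `let`-chain of the crux `RichardsonAnchorBEC` with the shift coefficient `2ργ`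
replaced by a free `κ`; the crux's functional is `anchorE γ (2 * ρ * γ) ρ n Λ` (definitionally:
`RichardsonAnchorBEC_iff`). Second-quantised: `⟨Φ, H_κ Φ⟩`, `H_κ = ∑_k k² n_k + κ ∑_{k ≠ 0} n_k +
(γ/2V) P†_M P_M`, `P_M = ∑_{k ∈ B_M} a_{-k} a_k` (zero mode included). [folklore] -/
def anchorE (γ κ ρ : ℝ) (n : ℕ) (Λ : ℝ) :
    PeriodicTrialState (n + 2) (sideLength ρ (n + 2)) → ℝ≥0∞ :=
  let N : ℕ := n + 2
  let L : ℝ := Literature.MathematicalPhysics.QuantumManyBody.BoseGas.sideLength ρ N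
  let M : ℕ := ⌊Λ * L / (2 * Real.pi)⌋₊
  let w : EuclideanSpace ℝ (Fin 3) → EuclideanSpace ℝ (Fin 3) → ℂ := fun x y =>
    ∑ m ∈ Fintype.piFinset (fun _ : Fin 3 => Finset.Icc (-(M : ℤ)) M),
      Complex.exp (2 * Real.pi * Complex.I / L * ∑ j : Fin 3, (m j : ℂ) * ((x j - y j : ℝ) : ℂ))
  fun Φ => Literature.MathematicalPhysics.QuantumManyBody.BoseGas.periodicEnergy 0 Φ +
    ENNReal.ofReal κ * ((N : ENNReal) -
      Literature.MathematicalPhysics.QuantumManyBody.BoseGas.condensateOccupation N L Φ.ψ) +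
    ENNReal.ofReal (γ / L ^ 9 * ((N : ℝ) * (N - 1) / 2)) *
      ∫⁻ Y in Literature.MathematicalPhysics.QuantumManyBody.BoseGas.cellN n L,
        (‖∫ x in Literature.MathematicalPhysics.QuantumManyBody.BoseGas.cell L,
            ∫ y in Literature.MathematicalPhysics.QuantumManyBody.BoseGas.cell L,
              (starRingEnd ℂ) (w x y) * Φ.ψ (Matrix.vecCons x (Matrix.vecCons y Y))‖₊ : ENNReal) ^ 2

/-- **Zero-energy pair bubble of the band** `J_M(L) = (1/(2L³)) ∑_{m ∈ B_M, m ≠ 0} 1/k_m²`,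
`k_m = 2π|m|/L`, `B_M = {-M,…,M}³` (ordered sum over the band's non-zero modes; `→ c_□ Λ`,
`c_□ = (16π³)⁻¹ ∫_{[-1,1]³} du/|u|²`, as `L → ∞` with `M = ⌊ΛL/2π⌋`). The band-limited zero-momentum
pair `T`-matrix of the anchor is the geometric (Born) series `γ/(1 + γ J_M)`. [folklore] -/
def bandBubble (L : ℝ) (M : ℕ) : ℝ :=
  1 / (2 * L ^ 3) * ∑ m ∈ (Fintype.piFinset (fun _ : Fin 3 => Finset.Icc (-(M : ℤ)) M)).erase 0,
    1 / ((2 * Real.pi / L) ^ 2 * ∑ j : Fin 3, ((m j : ℤ) : ℝ) ^ 2)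

/-- **Born-renormalised Hartree energy** of the anchor at density `ρ`, `N = n + 2`, `L = L_N(ρ)`,
`M = ⌊ΛL/2π⌋`: `e_ref = γ ρ N / (2 (1 + γ J_M(L)))` — the Hartree energy `γρN/2` of the pure
condensate divided by the pair-bubble resummation (for `N = 2` this is the exact lowest pair
energy of `(γ/2V)P†P` to leading order; for the dilute anchor it is `e₀ N (1 + O(√(ρ a_B³)))`). [folklore] -/
def bornEnergy (γ ρ : ℝ) (n : ℕ) (Λ : ℝ) : ℝ :=
  γ * ρ * ((n + 2 : ℕ) : ℝ) /
    (2 * (1 + γ * bandBubble (sideLength ρ (n + 2)) ⌊Λ * sideLength ρ (n + 2) / (2 * Real.pi)⌋₊))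

/-! ## Basic API -/

/-- The crux is, definitionally, the statement about `anchorE γ (2ργ) ρ n Λ`. [folklore] -/
theorem RichardsonAnchorBEC_iff :
    RichardsonAnchorBEC ↔
      ∀ γ Λ ε : ℝ, 0 ≤ γ → 0 < Λ → 0 < ε → ∃ ρ₀ : ℝ, 0 < ρ₀ ∧ ∀ ρ : ℝ, 0 < ρ → ρ < ρ₀ →
        ∀ᶠ n : ℕ in Filter.atTop, ∃ δ : ℝ≥0∞, 0 < δ ∧
          ∀ Ψ : PeriodicTrialState (n + 2) (sideLength ρ (n + 2)),
            anchorE γ (2 * ρ * γ) ρ n Λ Ψ ≤ (⨅ Φ, anchorE γ (2 * ρ * γ) ρ n Λ Φ) + δ →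
              ENNReal.ofReal ((1 - ε) * ((n + 2 : ℕ) : ℝ)) ≤
                condensateOccupation (n + 2) (sideLength ρ (n + 2)) Ψ.ψ :=
  Iff.rfl

/-- **Vocabulary stub**: the crux is, definitionally, the statement about `anchorE γ (2ργ) ρ n Λ` (witness
`Iff.rfl`; lands with the line's `Defs` file). [folklore] -/
theorem stub_anchorDefs :
    RichardsonAnchorBEC ↔
      ∀ γ Λ ε : ℝ, 0 ≤ γ → 0 < Λ → 0 < ε → ∃ ρ₀ : ℝ, 0 < ρ₀ ∧ ∀ ρ : ℝ, 0 < ρ → ρ < ρ₀ →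
        ∀ᶠ n : ℕ in Filter.atTop, ∃ δ : ℝ≥0∞, 0 < δ ∧
          ∀ Ψ : PeriodicTrialState (n + 2) (sideLength ρ (n + 2)),
            anchorE γ (2 * ρ * γ) ρ n Λ Ψ ≤ (⨅ Φ, anchorE γ (2 * ρ * γ) ρ n Λ Φ) + δ →
              ENNReal.ofReal ((1 - ε) * ((n + 2 : ℕ) : ℝ)) ≤
                condensateOccupation (n + 2) (sideLength ρ (n + 2)) Ψ.ψ :=
  Iff.rfl

/-- `L_N(ρ) > 0` for `ρ > 0`, `N = n + 2`. [folklore] -/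
theorem sideLength_succ_succ_pos {ρ : ℝ} (hρ : 0 < ρ) (n : ℕ) : 0 < sideLength ρ (n + 2) :=
  Real.rpow_pos_of_pos (div_pos (by positivity) hρ) _

/-- `J_M(L) ≥ 0` for `L ≥ 0`. [folklore] -/
theorem bandBubble_nonneg {L : ℝ} (hL : 0 ≤ L) (M : ℕ) : 0 ≤ bandBubble L M := by
  unfold bandBubble
  exact mul_nonneg (by positivity) (Finset.sum_nonneg fun m _ => by positivity)

/-- `e_ref ≥ 0` for `γ ≥ 0`, `ρ > 0`. [folklore] -/
theorem bornEnergy_nonneg {γ ρ : ℝ} (hγ : 0 ≤ γ) (hρ : 0 < ρ) (n : ℕ) (Λ : ℝ) :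
    0 ≤ bornEnergy γ ρ n Λ := by
  unfold bornEnergy
  have hJ := bandBubble_nonneg (sideLength_succ_succ_pos hρ n).le
    ⌊Λ * sideLength ρ (n + 2) / (2 * Real.pi)⌋₊
  positivity

/-- At `γ = 0` the anchor functional is the free kinetic energy. [folklore] -/
theorem anchorE_zero (ρ : ℝ) (n : ℕ) (Λ : ℝ) (Φ : PeriodicTrialState (n + 2) (sideLength ρ (n + 2))) :
    anchorE 0 (2 * ρ * 0) ρ n Λ Φ = periodicEnergy 0 Φ := by
  simp [anchorE]

end Summit.AtomisticToContinuum.BoseEinsteinCondensation.Cruxes.RichardsonAnchorBEC.Birth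

end
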